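import Literature.ModelTheory.ExponentialFields.SemialgebraicC1Cells
import Literature.NumberTheory.Transcendental.SemialgebraicMapsProofs
import HarnessLib

/-!
# `ContinuousCubification` (stmt-KontsevichZagierPeriods-17853) — line `korobov_damping`, stub `stub_c1CADRat`

Registered stub S1 of the line `korobov_damping` (skeleton `Lines/SketchIdeator1.lean`) of the crux
`ContinuousCubification` (route UnfoldedStokes): **the `ℚ`-scope `C¹` cylindrical cell
decomposition theorem**, clause `(I_m)` of [van den Dries 1998, Ch. 7 (3.2)] — every finite family of
`ℚ`-semialgebraic subsets of `ℝᵐ` is partitioned by a cylindrical decomposition of `ℝᵐ` with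
`ℚ`-semialgebraic cells, all of which are `ℚ`-semialgebraic `C¹` cells (`IsC1SACell ℚ`).

The tree proves the `ℝ`-scope form (`Literature.ModelTheory.ExponentialFields.c1_cell_decomposition`,
file `Literature/ModelTheory/ExponentialFields/SemialgebraicC1Cells.lean`). This file is the same
proof over an arbitrary coefficient ring `k` (`[CommRing k] [Algebra k ℝ]`): every input is already
`k`-scoped in the tree (`IsSemialgebraic.exists_cylindricalDecomposition_holds`,
`IsCylindricalDecomposition.exists_isCylinderStack`, `IsSemialgebraicFunOn.exists_contDiffOn_holds`,
`isSemialgebraic_interior`, `IsC1SACell.exists_c1_chart`). The proof is the strong induction on `m`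
of loc. cit. proving `(I_m)` and `(II_m)` together; the stub is the instance `k = ℚ` of `(I_m)`.

References: L. van den Dries, *Tame topology and o-minimal structures*, LMS LNS 248 (1998), Ch. 7
§3 (3.2); S. Basu, R. Pollack, M.-F. Roy, *Algorithms in Real Algebraic Geometry* (2006), Def. 5.1.
-/

-- `Summit.KontsevichZagierPeriods.KontsevichZagierPeriods.…` is the tree's mandated layout.
set_option linter.dupNamespace false

namespace Summit.KontsevichZagierPeriods.KontsevichZagierPeriods.ContinuousCubificationLine

open Set
open scoped ContDiff
open Literature.NumberTheory.Transcendental (IsSemialgebraicFunOn IsSemialgebraicMapOn)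
open Literature.ModelTheory.ExponentialFields

section Port

variable {k : Type*} [CommRing k] [Algebra k ℝ]

-- adapted from Literature/ModelTheory/ExponentialFields/SemialgebraicC1Cells.lean (k-scoped port)
/-- **Refining a stack over a refined base**, `k`-scoped form of `exists_refined_stack`: a
cylindrical decomposition of `ℝⁿ⁺¹` with `k`-semialgebraic cells, given as the stack of sections
`ξ_S` over a decomposition `𝒟'` of `ℝⁿ`, induces over any decomposition `ℰ'` of `ℝⁿ` partitioning
the cells of `𝒟'` the stack of the restricted sections, a cylindrical decomposition of `ℝⁿ⁺¹`
refining the given one. [cite: Dries1998, Ch. 7 (3.2)] -/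
theorem exists_refined_stack_k {n : ℕ} {𝒟 : Finset (Set (Fin (n + 1) → ℝ))}
    (h𝒟 : IsCylindricalDecomposition k (n + 1) 𝒟) {𝒟' : Finset (Set (Fin n → ℝ))}
    (h𝒟' : IsCylindricalDecomposition k n 𝒟') {l : Set (Fin n → ℝ) → ℕ}
    {ξ : (S : Set (Fin n → ℝ)) → Fin (l S) → (Fin n → ℝ) → ℝ}
    (hcont : ∀ S ∈ 𝒟', ∀ j, ContinuousOn (ξ S j) S)
    (hsa : ∀ S ∈ 𝒟', ∀ j, IsSemialgebraicFunOn k S (ξ S j))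
    (hmono : ∀ S ∈ 𝒟', ∀ x ∈ S, StrictMono fun j => ξ S j x)
    (hmem : ∀ T, T ∈ 𝒟 ↔ ∃ S ∈ 𝒟', (∃ j, T = graphOver S (ξ S j)) ∨ ∃ j, T = bandOver S (ξ S) j)
    {ℰ' : Finset (Set (Fin n → ℝ))} (hℰ' : IsCylindricalDecomposition k n ℰ')
    (href : ∀ S ∈ 𝒟', ∀ E ∈ ℰ', E ⊆ S ∨ Disjoint E S) :
    ∃ (Sf : Set (Fin n → ℝ) → Set (Fin n → ℝ)) (ℰ : Finset (Set (Fin (n + 1) → ℝ))),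
      (∀ E ∈ ℰ', Sf E ∈ 𝒟' ∧ E ⊆ Sf E) ∧
      IsCylindricalDecomposition k (n + 1) ℰ ∧
      (∀ T', T' ∈ ℰ ↔
        ∃ E ∈ ℰ', (∃ j, T' = graphOver E (ξ (Sf E) j)) ∨ ∃ j, T' = bandOver E (ξ (Sf E)) j) ∧
      (∀ T ∈ 𝒟, ∀ T' ∈ ℰ, T' ⊆ T ∨ Disjoint T' T) := by
  classical
  have hpart' := h𝒟'.isPartition
  have hpartE := hℰ'.isPartition
  have hpart := h𝒟.isPartition
  -- the base cell of `𝒟'` containing a cell of `ℰ'`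
  have hSf : ∀ E ∈ ℰ', ∃ S ∈ 𝒟', E ⊆ S := by
    intro E hE
    obtain ⟨x, hx⟩ : E.Nonempty := nonempty_iff_ne_empty.mpr fun h => hpartE.1 (h ▸ hE)
    obtain ⟨S, ⟨hS, hxS⟩, -⟩ := hpart'.2 x
    exact ⟨S, hS, (href S hS E hE).resolve_right fun h => Set.disjoint_left.mp h hx hxS⟩
  choose! Sf hSf𝒟 hESf using hSf
  -- uniqueness of the base cell
  have hSf_eq : ∀ E ∈ ℰ', ∀ S ∈ 𝒟', ∀ x ∈ E, x ∈ S → Sf E = S := fun E hE S hS x hxE hxS =>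
    hpart'.eq_of_mem_of_mem (hSf𝒟 E hE) hS (hESf E hE hxE) hxS
  -- the refined stack
  let cellsOver : Set (Fin n → ℝ) → Finset (Set (Fin (n + 1) → ℝ)) := fun E =>
    (Finset.univ.image fun j : Fin (l (Sf E)) => graphOver E (ξ (Sf E) j)) ∪
      (Finset.univ.image fun j : Fin (l (Sf E) + 1) => bandOver E (ξ (Sf E)) j)
  set ℰ : Finset (Set (Fin (n + 1) → ℝ)) := ℰ'.biUnion cellsOver with hℰ
  have hmemℰ : ∀ T', T' ∈ ℰ ↔ ∃ E ∈ ℰ', (∃ j, T' = graphOver E (ξ (Sf E) j)) ∨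
      ∃ j, T' = bandOver E (ξ (Sf E)) j := by
    intro T'
    simp only [hℰ, Finset.mem_biUnion, cellsOver, Finset.mem_union, Finset.mem_image,
      Finset.mem_univ, true_and]
    constructor <;>
    · rintro ⟨E, hE, ⟨j, hj⟩ | ⟨j, hj⟩⟩
      · exact ⟨E, hE, Or.inl ⟨j, hj.symm⟩⟩
      · exact ⟨E, hE, Or.inr ⟨j, hj.symm⟩⟩
  -- every refined cell is `X ∩ cylinder(E)` for a cell `X ∈ 𝒟` over `Sf E`
  have hparent : ∀ T' ∈ ℰ, ∃ E ∈ ℰ', ∃ X ∈ 𝒟, T' = X ∩ {z | Fin.init z ∈ E} := by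
    intro T' hT'
    obtain ⟨E, hE, ⟨j, rfl⟩ | ⟨j, rfl⟩⟩ := (hmemℰ T').mp hT'
    · exact ⟨E, hE, graphOver (Sf E) (ξ (Sf E) j), (hmem _).mpr ⟨Sf E, hSf𝒟 E hE, Or.inl ⟨j, rfl⟩⟩,
        graphOver_inter_cylinder (hESf E hE) _⟩
    · exact ⟨E, hE, bandOver (Sf E) (ξ (Sf E)) j, (hmem _).mpr ⟨Sf E, hSf𝒟 E hE, Or.inr ⟨j, rfl⟩⟩,
        bandOver_inter_cylinder (hESf E hE) _ _⟩
  -- conversely `X ∩ cylinder(E) ∈ ℰ` for `X ∈ 𝒟` over `S ⊇ E`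
  have hchild : ∀ X ∈ 𝒟, ∀ E ∈ ℰ', ∀ z ∈ X, Fin.init z ∈ E → X ∩ {z | Fin.init z ∈ E} ∈ ℰ := by
    intro X hX E hE z hzX hzE
    obtain ⟨S, hS, h⟩ := (hmem X).mp hX
    have hxS : Fin.init z ∈ S := by rcases h with ⟨j, rfl⟩ | ⟨j, rfl⟩ <;> exact hzX.1
    have hSfE : Sf E = S := hSf_eq E hE S hS _ hzE hxS
    subst hSfE
    rcases h with ⟨j, rfl⟩ | ⟨j, rfl⟩
    · exact (hmemℰ _).mpr ⟨E, hE, Or.inl ⟨j, (graphOver_inter_cylinder (hESf E hE) _).symm⟩⟩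
    · exact (hmemℰ _).mpr ⟨E, hE, Or.inr ⟨j, (bandOver_inter_cylinder (hESf E hE) _ _).symm⟩⟩
  -- nonemptiness of the refined cells
  have hne : ∀ T' ∈ ℰ, T'.Nonempty := by
    intro T' hT'
    obtain ⟨E, hE, h⟩ := (hmemℰ T').mp hT'
    obtain ⟨x, hx⟩ : E.Nonempty := nonempty_iff_ne_empty.mpr fun h => hpartE.1 (h ▸ hE)
    rcases h with ⟨j, rfl⟩ | ⟨j, rfl⟩
    · exact ⟨Fin.snoc x (ξ (Sf E) j x), by simp [hx]⟩
    · obtain ⟨m, -, hm'⟩ := exists_continuousOn_snoc_mem_bandOver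
        (fun i => (hcont _ (hSf𝒟 E hE) i).mono (hESf E hE))
        (fun y hy => hmono _ (hSf𝒟 E hE) y (hESf E hE hy)) j
      exact ⟨_, hm' x hx⟩
  -- refinement
  have hrefine : ∀ T ∈ 𝒟, ∀ T' ∈ ℰ, T' ⊆ T ∨ Disjoint T' T := by
    intro T hT T' hT'
    obtain ⟨E, -, X, hX, rfl⟩ := hparent T' hT'
    by_cases hXT : X = T
    · exact Or.inl (hXT ▸ inter_subset_left)
    · exact Or.inr (Set.disjoint_of_subset_left inter_subset_left (hpart.pairwiseDisjoint hX hT hXT))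
  have hcover : ∀ T ∈ 𝒟, ∀ z ∈ T, ∃ T' ∈ ℰ, z ∈ T' ∧ T' ⊆ T := by
    intro T hT z hz
    obtain ⟨E, ⟨hE, hzE⟩, -⟩ := hpartE.2 (Fin.init z)
    exact ⟨_, hchild T hT E hE z hz hzE, ⟨hz, hzE⟩, inter_subset_left⟩
  refine ⟨Sf, ℰ, fun E hE => ⟨hSf𝒟 E hE, hESf E hE⟩, ?_, hmemℰ, hrefine⟩
  -- the refined stack is a cylindrical decomposition
  rw [isCylindricalDecomposition_succ]
  refine ⟨⟨fun h => ?_, fun z => ?_⟩, fun T' hT' => ?_, ℰ', hℰ', ?_⟩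
  · exact not_nonempty_empty (hne ∅ h)
  · -- existence and uniqueness of the cell through `z`
    obtain ⟨T, ⟨hT, hzT⟩, -⟩ := hpart.2 z
    obtain ⟨T', hT', hzT', -⟩ := hcover T hT z hzT
    refine ⟨T', ⟨hT', hzT'⟩, fun T'' ⟨hT'', hzT''⟩ => ?_⟩
    obtain ⟨E₁, hE₁, X₁, hX₁, h₁⟩ := hparent T' hT'
    obtain ⟨E₂, hE₂, X₂, hX₂, h₂⟩ := hparent T'' hT''
    rw [h₁] at hzT' ⊢
    rw [h₂] at hzT'' ⊢
    rw [hpart.eq_of_mem_of_mem hX₁ hX₂ hzT'.1 hzT''.1,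
      hpartE.eq_of_mem_of_mem hE₁ hE₂ hzT'.2 hzT''.2]
  · -- semialgebraicity
    obtain ⟨E, hE, ⟨j, rfl⟩ | ⟨j, rfl⟩⟩ := (hmemℰ T').mp hT'
    · exact isSemialgebraicFunOn_iff_isSemialgebraic_graphOver.mp
        ((hsa _ (hSf𝒟 E hE) j).mono (hESf E hE) (hℰ'.isSemialgebraic E hE))
    · exact isSemialgebraic_bandOver' (hℰ'.isSemialgebraic E hE)
        (fun i => (hsa _ (hSf𝒟 E hE) i).mono (hESf E hE) (hℰ'.isSemialgebraic E hE)) j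
  · -- the stack structure
    exact ⟨fun E => l (Sf E), fun E => ξ (Sf E),
      fun E hE j => (hcont _ (hSf𝒟 E hE) j).mono (hESf E hE),
      fun E hE j => (hsa _ (hSf𝒟 E hE) j).mono (hESf E hE) (hℰ'.isSemialgebraic E hE),
      fun E hE x hx => hmono _ (hSf𝒟 E hE) x (hESf E hE hx), hmemℰ⟩

-- adapted from Literature/ModelTheory/ExponentialFields/SemialgebraicC1Cells.lean (k-scoped port)
/-- Cells of a `k`-cylindrical decomposition are nonempty. [cite: BasuPollackRoy2006, Def. 5.1] -/
theorem nonempty_of_mem_cd {m : ℕ} {𝒟 : Finset (Set (Fin m → ℝ))}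
    (h𝒟 : IsCylindricalDecomposition k m 𝒟) {C : Set (Fin m → ℝ)} (hC : C ∈ 𝒟) : C.Nonempty :=
  nonempty_iff_ne_empty.mpr fun h => h𝒟.isPartition.1 (h ▸ hC)

-- adapted from Literature/ModelTheory/ExponentialFields/SemialgebraicC1Cells.lean (k-scoped port)
/-- **The `C¹` cell decomposition theorem** [Dries1998, Ch. 7 (3.2)] with `k`-semialgebraic cells,
both clauses at once:
`(I_m)` every finite family of `k`-semialgebraic subsets of `ℝᵐ` is partitioned by a cylindrical
decomposition (with `k`-semialgebraic cells) into `k`-semialgebraic `C¹` cells;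
`(II_m)` for finitely many `k`-semialgebraic functions `fᵢ` on `Aᵢ ⊆ ℝᵐ` there is such a
decomposition partitioning the `Aᵢ` (and a given finite family) with every `fᵢ` of class `C¹` on
each cell contained in `Aᵢ`.
Proof as printed, with `(III_m)` replaced by generic smoothness
(`IsSemialgebraicFunOn.exists_contDiffOn_holds`). [cite: Dries1998, Ch. 7 (3.2)] -/
theorem c1_cell_decomposition_k : ∀ m : ℕ,
    (∀ 𝒜 : Finset (Set (Fin m → ℝ)), (∀ A ∈ 𝒜, IsSemialgebraic k A) →
      ∃ 𝒟 : Finset (Set (Fin m → ℝ)), (IsCylindricalDecomposition k m 𝒟 ∧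
        ∀ C ∈ 𝒟, ∃ d, IsC1SACell k m d C) ∧ ∀ A ∈ 𝒜, ∀ C ∈ 𝒟, C ⊆ A ∨ Disjoint C A) ∧
    (∀ (ι : Type) [Fintype ι] (A : ι → Set (Fin m → ℝ)) (f : ι → (Fin m → ℝ) → ℝ),
      (∀ i, IsSemialgebraicFunOn k (A i) (f i)) →
      ∀ 𝒜 : Finset (Set (Fin m → ℝ)), (∀ B ∈ 𝒜, IsSemialgebraic k B) →
        ∃ 𝒟 : Finset (Set (Fin m → ℝ)), (IsCylindricalDecomposition k m 𝒟 ∧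
          ∀ C ∈ 𝒟, ∃ d, IsC1SACell k m d C) ∧ (∀ B ∈ 𝒜, ∀ C ∈ 𝒟, C ⊆ B ∨ Disjoint C B) ∧
          (∀ i, ∀ C ∈ 𝒟, C ⊆ A i ∨ Disjoint C (A i)) ∧
          ∀ i, ∀ C ∈ 𝒟, C ⊆ A i → IsC1On (f i) C) := by
  intro m
  induction m using Nat.strong_induction_on with
  | _ m IH =>
  classical
  -- (I_m)
  have hI : ∀ 𝒜 : Finset (Set (Fin m → ℝ)), (∀ A ∈ 𝒜, IsSemialgebraic k A) →
      ∃ 𝒟 : Finset (Set (Fin m → ℝ)), (IsCylindricalDecomposition k m 𝒟 ∧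
        ∀ C ∈ 𝒟, ∃ d, IsC1SACell k m d C) ∧ ∀ A ∈ 𝒜, ∀ C ∈ 𝒟, C ⊆ A ∨ Disjoint C A := by
    intro 𝒜 h𝒜
    cases m with
    | zero =>
      refine ⟨{univ}, ⟨isCylindricalDecomposition_zero.mpr rfl, fun C hC => ?_⟩,
        fun A _ C hC => ?_⟩ <;> rw [Finset.mem_singleton] at hC <;> subst hC
      · exact ⟨0, IsC1SACell.zero⟩
      · rcases A.eq_empty_or_nonempty with rfl | ⟨a, ha⟩
        · exact Or.inr (disjoint_empty _)
        · exact Or.inl fun x _ => (Subsingleton.elim a x) ▸ ha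
    | succ m' =>
      -- an ordinary decomposition adapted to `𝒜`, as a stack over `𝒟'`
      obtain ⟨𝒟, h𝒟, hadapt⟩ :=
        IsSemialgebraic.exists_cylindricalDecomposition_holds (k := k) 𝒜 h𝒜
      obtain ⟨𝒟', h𝒟', l, ξ, hcont, hsa, hmono, hmem⟩ := h𝒟.exists_isCylinderStack
      -- make the sections `C¹` on a refinement of the base (II_{m'})
      obtain ⟨-, hII'⟩ := IH m' (Nat.lt_succ_self m')
      let ι : Type := Σ S : {S // S ∈ 𝒟'}, Fin (l S.1)
      obtain ⟨ℰ', ⟨hℰ', hℰ'cell⟩, hℰ'𝒟', -, hℰ'f⟩ := hII' ι (fun p => p.1.1)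
        (fun p => ξ p.1.1 p.2) (fun p => hsa p.1.1 p.1.2 p.2) 𝒟' (h𝒟'.isSemialgebraic)
      obtain ⟨Sf, ℰ, hSf, hℰ, hmemℰ, href⟩ := exists_refined_stack_k h𝒟 h𝒟' hcont hsa hmono
        hmem hℰ' (fun S hS E hE => hℰ'𝒟' S hS E hE)
      refine ⟨ℰ, ⟨hℰ, fun T' hT' => ?_⟩, fun A hA T' hT' => ?_⟩
      · -- the refined cells are `C¹` cells
        obtain ⟨E, hE, h⟩ := (hmemℰ T').mp hT'
        obtain ⟨d, hEcell⟩ := hℰ'cell E hE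
        have hSE := hSf E hE
        have hc : ∀ j, ContinuousOn (ξ (Sf E) j) E := fun j => (hcont _ hSE.1 j).mono hSE.2
        have hs : ∀ j, IsSemialgebraicFunOn k E (ξ (Sf E) j) := fun j =>
          (hsa _ hSE.1 j).mono hSE.2 (hℰ'.isSemialgebraic E hE)
        have h1 : ∀ j, IsC1On (ξ (Sf E) j) E := fun j =>
          hℰ'f ⟨⟨Sf E, hSE.1⟩, j⟩ E hE hSE.2
        rcases h with ⟨j, rfl⟩ | ⟨j, rfl⟩
        · exact ⟨d, hEcell.graph (hc j) (hs j) (h1 j)⟩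
        · exact ⟨d + 1, IsC1SACell.band j hEcell hc hs h1 fun x hx => hmono _ hSE.1 x (hSE.2 hx)⟩
      · -- adaptedness to `𝒜`: `T'` lies in a cell `T` of `𝒟`, itself inside or off `A`
        obtain ⟨z, hz⟩ := nonempty_of_mem_cd hℰ hT'
        obtain ⟨T, ⟨hT, hzT⟩, -⟩ := h𝒟.isPartition.2 z
        exact subset_or_disjoint_of_subset
          ((href T hT T' hT').resolve_right fun h => Set.disjoint_left.mp h hz hzT)
          (h𝒟.subset_or_disjoint (hadapt A hA) hT)
  refine ⟨hI, ?_⟩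
  -- (II_m)
  intro ι _ A f hf 𝒜 h𝒜
  -- generic smoothness on the interiors
  have hsmooth : ∀ i, ∃ Z : Set (Fin m → ℝ), Z ⊆ interior (A i) ∧ IsSemialgebraic k Z ∧
      interior Z = ∅ ∧ IsOpen (interior (A i) \ Z) ∧ ContDiffOn ℝ ∞ (f i) (interior (A i) \ Z) :=
    fun i => IsSemialgebraicFunOn.exists_contDiffOn_holds (k := k) isOpen_interior
      ((hf i).mono interior_subset
        (isSemialgebraic_interior (IsSemialgebraicFunOn.isSemialgebraic_holds (hf i))))
  choose Z hZA hZs hZint hZopen hZsmooth using hsmooth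
  have hAs : ∀ i, IsSemialgebraic k (A i) := fun i =>
    IsSemialgebraicFunOn.isSemialgebraic_holds (hf i)
  -- first decomposition
  set 𝒜₁ : Finset (Set (Fin m → ℝ)) := 𝒜 ∪ Finset.univ.image A ∪
    Finset.univ.image (fun i => interior (A i) \ Z i) with h𝒜₁
  have h𝒜₁ : ∀ B ∈ 𝒜₁, IsSemialgebraic k B := by
    intro B hB
    rcases Finset.mem_union.mp hB with hB | hB
    · rcases Finset.mem_union.mp hB with hB | hB
      · exact h𝒜 B hB
      · obtain ⟨i, -, rfl⟩ := Finset.mem_image.mp hB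
        exact hAs i
    · obtain ⟨i, -, rfl⟩ := Finset.mem_image.mp hB
      exact (isSemialgebraic_interior (hAs i)).diff (hZs i)
  obtain ⟨𝒟, ⟨h𝒟, h𝒟cell⟩, h𝒟adapt⟩ := hI 𝒜₁ h𝒜₁
  -- the pieces of each cell on which `f i` is `C¹`
  have hpieces : ∀ C ∈ 𝒟, ∀ i, C ⊆ A i → ∃ Pc : Finset (Set (Fin m → ℝ)),
      (∀ P ∈ Pc, IsSemialgebraic k P ∧ IsC1On (f i) P) ∧ C ⊆ ⋃ P ∈ Pc, P := by
    intro C hC i hCA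
    obtain ⟨d, hcell⟩ := h𝒟cell C hC
    by_cases hd : d = m
    · -- open cell: inside `interior (A i) ∖ Z i`
      subst hd
      have hCo : IsOpen C := hcell.isSACell.isOpen rfl
      have hCint : C ⊆ interior (A i) := interior_maximal hCA hCo
      have hmemZ : interior (A i) \ Z i ∈ 𝒜₁ :=
        Finset.mem_union_right _ (Finset.mem_image.mpr ⟨i, Finset.mem_univ _, rfl⟩)
      have hCZ : C ⊆ interior (A i) \ Z i := by
        refine (h𝒟adapt _ hmemZ C hC).resolve_right fun h => ?_
        have hCZ' : C ⊆ Z i := fun x hx => by_contra fun hxZ =>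
          Set.disjoint_left.mp h hx ⟨hCint hx, hxZ⟩
        have := interior_mono hCZ'
        rw [hZint i, hCo.interior_eq] at this
        exact not_nonempty_empty ((nonempty_of_mem_cd h𝒟 hC).mono this)
      refine ⟨{C}, fun P hP => ?_, by simp⟩
      rw [Finset.mem_singleton] at hP
      subst hP
      exact ⟨h𝒟.isSemialgebraic _ hC,
        IsC1On.of_contDiffOn (hZopen i) ((hZsmooth i).of_le (by exact_mod_cast le_top)) hCZ⟩
    · -- lower-dimensional cell: through the `C¹` chart and `(II_d)`
      have hdm : d < m := lt_of_le_of_ne hcell.isSACell.le hd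
      obtain ⟨ιC, U, φ, -, hU, hUeq, -, hφs, -, hleft, hright⟩ := hcell.exists_c1_chart
      have hφC : MapsTo φ U C := fun u hu => (hright u hu).1
      have hg : IsSemialgebraicFunOn k U (f i ∘ φ) :=
        IsSemialgebraicFunOn.comp_isSemialgebraicMapOn_holds
          ((hf i).mono hCA (h𝒟.isSemialgebraic C hC)) hφs hφC
      obtain ⟨-, hIId⟩ := IH d hdm
      obtain ⟨ℬ, ⟨hℬ, -⟩, -, hℬU, hℬg⟩ := hIId Unit (fun _ => U) (fun _ => f i ∘ φ) (fun _ => hg) ∅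
        (by simp)
      let p : (Fin m → ℝ) → (Fin d → ℝ) := fun x => x ∘ ιC
      have hp : ContDiff ℝ 1 p := contDiff_pi.mpr fun j => contDiff_apply ℝ ℝ (ιC j)
      refine ⟨(ℬ.filter fun B => B ⊆ U).image fun B => C ∩ {x | p x ∈ B}, fun P hP => ?_,
        fun x hx => ?_⟩
      · obtain ⟨B, hB, rfl⟩ := Finset.mem_image.mp hP
        obtain ⟨hBℬ, hBU⟩ := Finset.mem_filter.mp hB
        refine ⟨(h𝒟.isSemialgebraic C hC).inter ((hℬ.isSemialgebraic B hBℬ).preimage_comp ιC), ?_⟩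
        have h1 : IsC1On ((f i ∘ φ) ∘ p) (C ∩ {x | p x ∈ B}) :=
          (hℬg () B hBℬ hBU).comp_contDiff hp fun x hx => hx.2
        exact h1.congr fun x hx => by
          show f i (φ (x ∘ ιC)) = f i x
          rw [hleft x hx.1]
      · have hxU : p x ∈ U := hUeq ▸ ⟨x, hx, rfl⟩
        obtain ⟨B, ⟨hB, hxB⟩, -⟩ := hℬ.isPartition.2 (p x)
        have hBU : B ⊆ U :=
          (hℬU () B hB).resolve_right fun h => Set.disjoint_left.mp h hxB hxU
        simp only [mem_iUnion, Finset.mem_image, Finset.mem_filter, exists_prop]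
        exact ⟨_, ⟨B, ⟨hB, hBU⟩, rfl⟩, hx, hxB⟩
  choose! Pf hPf hPcover using hpieces
  -- second decomposition, partitioning the cells of the first and all the pieces
  set Pall : Finset (Set (Fin m → ℝ)) := 𝒟.biUnion fun C => Finset.univ.biUnion fun i =>
    if C ⊆ A i then Pf C i else ∅ with hPall
  have hPall' : ∀ P ∈ Pall, ∃ C ∈ 𝒟, ∃ i, C ⊆ A i ∧ P ∈ Pf C i := by
    intro P hP
    rw [hPall] at hP
    obtain ⟨C, hC, hP⟩ := Finset.mem_biUnion.mp hP
    obtain ⟨i, -, hP⟩ := Finset.mem_biUnion.mp hP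
    by_cases h : C ⊆ A i
    · rw [if_pos h] at hP
      exact ⟨C, hC, i, h, hP⟩
    · rw [if_neg h] at hP
      exact absurd hP (Finset.notMem_empty P)
  have hPcmem : ∀ C ∈ 𝒟, ∀ i, C ⊆ A i → ∀ P ∈ Pf C i, P ∈ Pall := by
    intro C hC i hCA P hP
    rw [hPall]
    refine Finset.mem_biUnion.mpr ⟨C, hC, Finset.mem_biUnion.mpr ⟨i, Finset.mem_univ _, ?_⟩⟩
    rw [if_pos hCA]
    exact hP
  set 𝒜₂ : Finset (Set (Fin m → ℝ)) := 𝒜₁ ∪ 𝒟 ∪ Pall with h𝒜₂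
  have h𝒜₂ : ∀ B ∈ 𝒜₂, IsSemialgebraic k B := by
    intro B hB
    rcases Finset.mem_union.mp hB with hB | hB
    · rcases Finset.mem_union.mp hB with hB | hB
      · exact h𝒜₁ B hB
      · exact h𝒟.isSemialgebraic B hB
    · obtain ⟨C, hC, i, hCA, hP⟩ := hPall' B hB
      exact (hPf C hC i hCA B hP).1
  obtain ⟨𝒟₂, h𝒟₂, h𝒟₂adapt⟩ := hI 𝒜₂ h𝒜₂
  have hA𝒜₂ : ∀ i, A i ∈ 𝒜₂ := fun i => Finset.mem_union_left _ (Finset.mem_union_left _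
    (Finset.mem_union_left _ (Finset.mem_union_right _
      (Finset.mem_image.mpr ⟨i, Finset.mem_univ _, rfl⟩))))
  refine ⟨𝒟₂, h𝒟₂, fun B hB C hC => h𝒟₂adapt B (Finset.mem_union_left _ (Finset.mem_union_left _
    (Finset.mem_union_left _ (Finset.mem_union_left _ hB)))) C hC,
    fun i C hC => h𝒟₂adapt _ (hA𝒜₂ i) C hC, fun i C' hC' hC'A => ?_⟩
  -- `f i` is `C¹` on the cells of `𝒟₂` inside `A i`
  obtain ⟨z, hz⟩ := nonempty_of_mem_cd h𝒟₂.1 hC'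
  obtain ⟨C, ⟨hC, hzC⟩, -⟩ := h𝒟.isPartition.2 z
  have hC'C : C' ⊆ C :=
    (h𝒟₂adapt C (Finset.mem_union_left _ (Finset.mem_union_right _ hC)) C' hC').resolve_right
      fun h => Set.disjoint_left.mp h hz hzC
  have hCA : C ⊆ A i := by
    have hA1 : A i ∈ 𝒜₁ := Finset.mem_union_left _ (Finset.mem_union_right _
      (Finset.mem_image.mpr ⟨i, Finset.mem_univ _, rfl⟩))
    exact (h𝒟adapt _ hA1 C hC).resolve_right fun h => Set.disjoint_left.mp h hzC (hC'A hz)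
  have hzP := hPcover C hC i hCA hzC
  simp only [mem_iUnion, exists_prop] at hzP
  obtain ⟨P, hP, hzP⟩ := hzP
  have hC'P : C' ⊆ P :=
    (h𝒟₂adapt P (Finset.mem_union_right _ (hPcmem C hC i hCA P hP)) C' hC').resolve_right
      fun h => Set.disjoint_left.mp h hz hzP
  exact (hPf C hC i hCA P hP).2.mono hC'P

end Port

/-! ## The registered stub -/

/-- STUB S1 of the line `korobov_damping`: **`ℚ`-scope `C¹` cell decomposition, clause `(I_m)`**
[Dries1998, Ch. 7 (3.2)] — every finite family of `ℚ`-semialgebraic subsets of `ℝᵐ` is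
partitioned by a cylindrical decomposition of `ℝᵐ` with `ℚ`-semialgebraic cells, all of which are
`ℚ`-semialgebraic `C¹` cells; the instance `k = ℚ` of `c1_cell_decomposition_k`.
[cite: Dries1998, Ch. 7 (3.2)] -/
theorem stub_c1CADRat :
    ∀ (m : ℕ) (𝒜 : Finset (Set (Fin m → ℝ))), (∀ A ∈ 𝒜, IsSemialgebraic ℚ A) →
      ∃ 𝒟 : Finset (Set (Fin m → ℝ)), IsCylindricalDecomposition ℚ m 𝒟 ∧
        (∀ C ∈ 𝒟, ∃ d, IsC1SACell ℚ m d C) ∧ ∀ A ∈ 𝒜, ∀ C ∈ 𝒟, C ⊆ A ∨ Disjoint C A := by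
  intro m 𝒜 h𝒜
  obtain ⟨𝒟, ⟨h𝒟, hcell⟩, hadapt⟩ := (c1_cell_decomposition_k (k := ℚ) m).1 𝒜 h𝒜
  exact ⟨𝒟, h𝒟, hcell, hadapt⟩

end Summit.KontsevichZagierPeriods.KontsevichZagierPeriods.ContinuousCubificationLine
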